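import Literature.Geometry.Lorentzian.KerrCylinderSpinExpansionK
import Summits.FinalStateConjecture.FinalStateConjecture.Theorems.EIHFluxBalanceInertialRecessionSlavingFarFieldVarCalculus
import Summits.FinalStateConjecture.FinalStateConjecture.Theorems.EIHFluxBalanceInertialRecessionSlavingFarFieldSpinLie

/-!
# Route EIHFluxBalance — `InertialRecession` (E′), K1 / stub `stub_coerMomKernel` (Bk), far field, part F3c:
# the spin-dipole term `Kerr.spinMetric` is smooth off the time axis; its lab first-variation field

Helper file for the crux `stmt-FinalStateConjecture-17403`. `Kerr.spinMetric M = ∂_a g_{M,a}|_{a=0}` is `C^∞` off the time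
axis (`contDiffAt_spinMetric`, from the joint smoothness `contDiffAt_bilin_spin₂` of `(a, x) ↦ g_{M,a}(x)` — the general
principle `contDiffAt_partialField`), hence the lab first-variation field built on it (Bk's `Var` with `K = spinMetric M`)
is differentiable and `fderiv_lieVar_apply` (F2a) applies (`differentiableAt_spinVar`, `fderiv_spinVar_apply`); and its
POINTWISE value for a rotation generator `A = R_ω` (`d = 0`) is `M` times the Lense–Thirring closed form with spin vector
`(−ω₂, ω₁, 0)` of the spin-row tables (`spinVar_apply_eq`, from `fderiv_rotation_spinMetric`, F3b).
No definitions, no `sorry`. [folklore]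
-/

set_option linter.dupNamespace false
-- instance search through the nested operator types (as in the skeleton / `ChartCurvature`)
set_option maxSynthPendingDepth 6
set_option synthInstance.maxHeartbeats 200000

noncomputable section

open scoped Topology InnerProductSpace
open Filter Set Function Literature.Geometry.Lorentzian Literature.Geometry.Lorentzian.Schwarzschild

namespace Summit.FinalStateConjecture.FinalStateConjecture.Theorems.SublinearIsFree.Slaving

/-- **The first-order field `S(z) = ∂_a Φ(0, z)` of a `C^{n+1}` map is `Cⁿ`** (cf. `differentiableAt_partialField`).
[folklore] -/
theorem contDiffAt_partialField {E F : Type*} [NormedAddCommGroup E] [NormedSpace ℝ E] [NormedAddCommGroup F]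
    [NormedSpace ℝ F] {Φ : ℝ × E → F} {x₀ : E} {S : E → F} (n : ℕ)
    (hΦ : ContDiffAt ℝ (n + 1) Φ (0, x₀)) (hS : ∀ᶠ z in 𝓝 x₀, HasDerivAt (fun a ↦ Φ (a, z)) (S z) 0) :
    ContDiffAt ℝ n S x₀ := by
  have hD : ContDiffAt ℝ n (fderiv ℝ Φ) (0, x₀) := hΦ.fderiv_right (m := n) le_rfl
  have hdiff : ∀ᶠ z in 𝓝 x₀, DifferentiableAt ℝ Φ (0, z) := by
    have h1 : ∀ᶠ q in 𝓝 ((0 : ℝ), x₀), DifferentiableAt ℝ Φ q :=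
      (hΦ.eventually (by simp)).mono fun q hq ↦ hq.differentiableAt (by simp)
    exact (continuousAt_const.prodMk continuousAt_id).eventually (by simpa using h1)
  have hev : (fun z ↦ fderiv ℝ Φ (0, z) (1, 0)) =ᶠ[𝓝 x₀] S := by
    filter_upwards [hdiff, hS] with z hz hSz
    exact (hasDerivAt_curry_fst_slot hz).unique hSz
  have h2 : ContDiffAt ℝ n (fun z : E ↦ fderiv ℝ Φ (0, z) ((1 : ℝ), (0 : E))) x₀ := by
    have hf : ContDiffAt ℝ n (fun z : E ↦ (((0 : ℝ), z) : ℝ × E)) x₀ := contDiffAt_const.prodMk contDiffAt_id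
    exact (hD.comp x₀ hf).clm_apply contDiffAt_const
  exact h2.congr_of_eventuallyEq hev.symm

/-- **`Kerr.spinMetric M` is `C^∞` off the time axis.** [folklore] -/
theorem contDiffAt_spinMetric (M : ℝ) {x : E4} (hx : 0 < Kerr.radius 0 x) (n : ℕ) :
    ContDiffAt ℝ n (Kerr.spinMetric M) x := by
  have hΦ := LiMei.contDiffAt_bilin_spin₂ M (q := ((0 : ℝ), x)) hx (n := (n + 1 : ℕ))
  refine contDiffAt_partialField (Φ := fun q : ℝ × E4 ↦ Kerr.bilin M q.1 q.2) n (by exact_mod_cast hΦ) ?_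
  have ho : IsOpen {z : E4 | 0 < Kerr.radius 0 z} := isOpen_lt continuous_const (Kerr.continuous_radius 0)
  filter_upwards [ho.mem_nhds hx] with z hz
  exact Kerr.hasDerivAt_bilin_spin M hz

/-- The lab first-variation field of the spin term (Bk's `Var` with `K = spinMetric M`) is differentiable wherever the
rest image is off the time axis. [folklore] -/
theorem differentiableAt_spinVar (M : ℝ) (Li A : E4 →L[ℝ] E4) (d : E4) {x : E4} (hx : 0 < Kerr.radius 0 (Li x)) :
    DifferentiableAt ℝ (fun z : E4 ↦ (fderiv ℝ (Kerr.spinMetric M) (Li z) (A (Li z) + d)).bilinearComp Li Li +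
        (Kerr.spinMetric M (Li z)).bilinearComp (A.comp Li) Li + (Kerr.spinMetric M (Li z)).bilinearComp Li (A.comp Li)) x :=
  (hasFDerivAt_lieVar (Kerr.spinMetric M) Li A d (by exact_mod_cast contDiffAt_spinMetric M hx 2)).differentiableAt

/-- **The derivative of the spin first-variation field in rest-frame terms** (F2a specialised to `spinMetric`). [folklore] -/
theorem fderiv_spinVar_apply (M : ℝ) (Li A : E4 →L[ℝ] E4) (d : E4) {x : E4} (hx : 0 < Kerr.radius 0 (Li x)) (w a b : E4) :
    fderiv ℝ (fun z : E4 ↦ (fderiv ℝ (Kerr.spinMetric M) (Li z) (A (Li z) + d)).bilinearComp Li Li +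
        (Kerr.spinMetric M (Li z)).bilinearComp (A.comp Li) Li + (Kerr.spinMetric M (Li z)).bilinearComp Li (A.comp Li)) x w a b =
      fderiv ℝ (fun y' ↦ fderiv ℝ (Kerr.spinMetric M) y' (A (Li x) + d) (Li a) (Li b)) (Li x) (Li w) +
        fderiv ℝ (Kerr.spinMetric M) (Li x) (A (Li w)) (Li a) (Li b) +
        fderiv ℝ (Kerr.spinMetric M) (Li x) (Li w) (A (Li a)) (Li b) +
        fderiv ℝ (Kerr.spinMetric M) (Li x) (Li w) (Li a) (A (Li b)) :=
  fderiv_lieVar_apply (Kerr.spinMetric M) Li A d (by exact_mod_cast contDiffAt_spinMetric M hx 2) w a b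

/-- **Pointwise value of the spin first-variation field for a rotation generator** (`d = 0`): `M` times the Lense–Thirring
closed form with spin vector `(−ω₂, ω₁, 0)` at the rest point `y = Li z` — the `hS`-form of `…SlavingFarFieldSpinRowsA/B`
(with `Li = L⁻¹`). [folklore] -/
theorem spinVar_apply_eq (M : ℝ) (Li R : E4 →L[ℝ] E4) (ω₁ ω₂ ω₃ : ℝ)
    (hR : ∀ u : E4, R u = ![0, ω₂ * u 3 - ω₃ * u 2, ω₃ * u 1 - ω₁ * u 3, ω₁ * u 2 - ω₂ * u 1])
    {z : E4} (hz : 0 < Kerr.radius 0 (Li z)) (u w : E4) :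
    ((fderiv ℝ (Kerr.spinMetric M) (Li z) (R (Li z) + 0)).bilinearComp Li Li +
        (Kerr.spinMetric M (Li z)).bilinearComp (R.comp Li) Li + (Kerr.spinMetric M (Li z)).bilinearComp Li (R.comp Li)) u w =
      2 * M / E4.spatialNorm (Li z) ^ 3 *
        (ell (Li z) (Li u) * sdot (Li z) (WithLp.toLp 2 ![(0 : ℝ), ω₁ * (Li w) 3 - 0 * (Li w) 2, 0 * (Li w) 1 - -ω₂ * (Li w) 3,
            -ω₂ * (Li w) 2 - ω₁ * (Li w) 1]) +
          sdot (Li z) (WithLp.toLp 2 ![(0 : ℝ), ω₁ * (Li u) 3 - 0 * (Li u) 2, 0 * (Li u) 1 - -ω₂ * (Li u) 3,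
            -ω₂ * (Li u) 2 - ω₁ * (Li u) 1]) * ell (Li z) (Li w)) := by
  have hsp : E4.spatial (Li z) ≠ 0 := by
    rw [Kerr.radius_zero_left, E4.spatialNorm] at hz; exact norm_pos_iff.1 hz
  have hd : DifferentiableAt ℝ (Kerr.spinMetric M) (Li z) := (contDiffAt_spinMetric M hz 1).differentiableAt one_ne_zero
  rw [add_zero]
  simp only [FunLike.coe_add, Pi.add_apply, ContinuousLinearMap.bilinearComp_apply, ContinuousLinearMap.comp_apply]
  exact fderiv_rotation_spinMetric M hsp hd ω₁ ω₂ ω₃ R hR (Li u) (Li w)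

/-- Registered carrier `slaving_farFieldSpinSmooth_slaving12` of the crux item (= `contDiffAt_spinMetric`). [folklore] -/
theorem slaving_farFieldSpinSmooth_slaving12 : open Literature.Geometry.Lorentzian in ∀ (M : ℝ) {x : E4}, 0 < Kerr.radius 0 x → ∀ n : ℕ, ContDiffAt ℝ n (Kerr.spinMetric M) x :=
  fun M _ hx n ↦ contDiffAt_spinMetric M hx n

end Summit.FinalStateConjecture.FinalStateConjecture.Theorems.SublinearIsFree.Slaving
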